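import Summits.QuantumFields.YangMills.Theorems.UnitScaleTiltProp7CovBlockGaussIntTransport
import Summits.QuantumFields.YangMills.Theorems.UnitScaleTiltProp7CovFaceFluxPairing
import Summits.QuantumFields.YangMills.Theorems.UnitScaleTiltProp7FlatHolonomy
import HarnessLib

/-!
# Route `UnitScaleTilt`, crux K1 «MinimiserStabilityRegPr» (stmt-QuantumFields-19200), route-R E′ S3 K-form engine, row (P′) — «GAUSS-SPLIT» (the HXB′ door's core):
# the Gauss pairing of the coarse covariant differences `D_c = φ(c₋) − W̄_c·φ(c₊)·W̄_c*` with the COMB-DIRECT face functional (far layer, comb from the block corner, frame `g_y`)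
# SPLITS EXACTLY into the Dirichlet pairing of the comb local models with `B` on the blocks' interior bonds plus the junction pairing, and is BOOKED:
# `2|Σ_c Re tr(D_cᴴ·FACE°_c)| ≤ a·DIR^{HS}_int(Ψ^T) + a⁻¹·M^{HS}(B) + 2|Σ_y Re tr(φ(y)ᴴ·J_VH(y))|` for every `a > 0` — hXb′ ⟸ hDirGauss ∧ hVH up to the knit's scalars

Cell `ym3-torus`, width seat `ym3-torus-px15` (gen 3); hXb-inhabitant lane («BLOCK-GAUSS» GO, ★ym-ust-19200-p1 g16 WORD 10 (2); WORD 17 «px15: Σ₁∕J_VH»; LOCATE-HXB-SPLIT-px15g3 b74b2f1b11a84a73).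
THEOREMS ONLY (0 `def`, 0 `sorry`, 0 `instance`); `--supports stmt-QuantumFields-19200`, count-neutral.  YM₃ on T³ is a ladder rung (R3), not the Clay problem; nothing here claims a stub, the crux,
d = 4 or the mass gap.

LETTERS.  Finest torus, level `k` (`h : sitesPerDir 0 = L^k·sitesPerDir k`, `k ≤ m + K`); `V : PBond P 0 → (M_N ℂ)ˣ` unitary-valued (the knit: `unitsField (toUField W)`); coarse bond units
`Wc : PBond P k → (M_N ℂ)ˣ` unitary (the knit: `unitsField (toUField W̄)`, `W̄` the `k`-fold average — then `(Wc c : M) = ↑(W̄ c)` by `rfl`); frames `g : Site P k → (M_N ℂ)ˣ` unitary (px5's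
`gL c = ↑(holAt W (walk (embIter k c.src) (treeWord (−(ℓ−1)∕2))))`); `φ : Site P k → M_N ℂ` (the knit: `φ₀ ∘ embIter k`); `B : Fin d → Site P 0 → M_N ℂ` (`B μ x := B⟨x, μ⟩`, covariantly co-closed).
`ȳ_y := fibreSite 0 k y 0` (corner), `x^y_r := fibreSite 0 k y r`, `T_y(x) := g_y · axialT V ȳ_y x` (frame ∘ corner comb), `Ψ^{T_y}(z) := R(T_y z)⁻¹ φ(y)`.
`FACE°_c := (g c₋)·(Σ_{r̄ : r̄_μ+1 = L^k} conjR(holT V ȳ (treeWord r̄))(B_μ(x_r̄)))·(g c₋)*` — px5's ✓p680744 `FACE` after ✓p670095 (FACE→FACE′) and the line-mates regrouping, WITHOUT the scalar `V_k⁻¹ℓ²`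
(`faceSum_allOffsets_eq_far` below is that regrouping in px5's `t₀ = ℓ−1−r_μ`, `s′ = ℓ−1` letters).

WHAT IS PROVED (ns `…Theorems.Prop7GaussCompositeSplit`).
* §1 `rel_corner_fibreSite` (`rel ȳ x_r = r`, no wrap), ★ `axialT_corner_fibreSite` (`axialT V ȳ x_r = holT V ȳ (treeWord r)` — px5's `w c r` IS the corner axial transport), `faceFar_eq_out`
  (`FACE°_c = Σ_{far} R(T_{c₋}(x_r̄))(B_μ(x_r̄))`), `star_mul_mul_eq_R_inv` (`W*·Z·W = R(W⁻¹)Z` for unitary units), ★ `faceSum_allOffsets_eq_far` (line-mates, px5's letters).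
* §2 ★★★ `gauss_pairing_eq_int_add_junction` — EXACT: `Σ_c Re tr(D_cᴴ·FACE°_c) = Σ_y Σ_μ Σ_{int} Re tr((D_{V,μ}Ψ^{T_y}(x_r))ᴴ·B_μ(x_r)) + Σ_y Re tr(φ(y)ᴴ·J_VH(y))` (✓p670399 ∘ ✓p680975 ∘ ✓p684144).
* §4 `combFace_allOffsets_eq_smul_far`, ★★★ `two_mul_abs_gauss_pairing_allOffsets_le` — the same in px5's all-offsets `FACE′` letters with the scalars `V_k⁻¹`, `ℓ •`
  (factor `V_k⁻¹·ℓ·L^k` in front).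
* §3 ★★★ `two_mul_abs_gauss_pairing_le` — THE DOOR: `2|Σ_c Re tr(D_cᴴ·FACE°_c)| ≤ a·Σ_yΣ_μΣ_{int}|D_{V,μ}Ψ^{T_y}(x_r)|²_HS + a⁻¹·Σ_xΣ_μ|B_μ(x)|²_HS + 2|Σ_y Re tr(φ(y)ᴴ·J_VH(y))|`, any `a > 0`.
HONEST SCOPE.  Composition of landed theorems; the two displayed quantities (the comb family's interior Dirichlet energy — hDir-type — and the junction pairing `J_VH` — px17's hVH) are NOT estimated
here; the knit's scalars `V_k⁻¹ℓ²`, the (G2) face defect (✓p670095, paid in `hE′` ✓p684329) and the constants are the assembler's.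

References: T. Bałaban, CMP 95 (1984) 17–40 [Balaban1984PropagatorsI] ((1.18)–(1.21) pp.20–21); CMP 98 (1985) 17–51 [Balaban1985Averaging] ((8)–(9) pp.18–19, p.24);
CMP 99 (1985) 389–434 [Balaban1985BackgroundPropagators] ((3.3)–(3.5) pp.390–391, (3.8) p.392); CMP 102 (1985) 277–309 [Balaban1985Variational] ((135) p.298, Prop. 7 p.299);
CMP 102 (1985) 255–275 [Balaban1985UV3] ((27) p.263).
-/

set_option autoImplicit false

noncomputable section

open scoped BigOperators Matrix Matrix.Norms.L2Operator

namespace Summit.QuantumFields.YangMills.Theorems.Prop7GaussCompositeSplit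

open Literature.MathematicalPhysics.QuantumFieldTheory.Balaban1983to89
open Finset
open B7Prop1Explicit (treeWord)
open B7Prop2Explicit (unitaryUnits mem_unitaryUnits)
open B7Eq78Linearization (conjR)
open B9Eq39Adjoint (R R_mul_R covD divB)
open B9TorusCalculus (torusT)
open B10Eq27TorusAxialLog (holT axialT rel transl rel_transl_of_mem)
open Summit.QuantumFields.YangMills.Theorems.Prop7CovariantCoercivity (coe_inv_eq_star inv_mem_unitary)
open Summit.QuantumFields.YangMills.Theorems.Prop7CovBlockGauss (sum_eq_sum_far_layer_lines block_netFlux_eq_int_add_junction update_update_eq_self)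
open Summit.QuantumFields.YangMills.Theorems.Prop7CovBlockGaussIntPairing (axialT_mem_unitary)
open Summit.QuantumFields.YangMills.Theorems.Prop7CovBlockGaussIntTransport (re_trace_int_eq_sum_covD_pairing_of_transport two_mul_abs_int_pairing_le_of_transport)
open Summit.QuantumFields.YangMills.Theorems.Prop7CovFaceFluxPairing (sum_re_trace_pureGauge_mul_eq)
open Summit.QuantumFields.YangMills.Theorems.Prop7CovRightInverse (fibreSite_eq_transl iterate_shift_fibreSite_of_lt)
open Summit.QuantumFields.YangMills.Theorems.Prop7FlatHolonomy (sitesPerDir_zero_eq_mul_pow)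

variable {P : Params} {k : ℕ} {N : ℕ}

/-! ## §1 Letters: the corner comb is the corner axial transport; the far-layer face functional is the Gauss law's outflow -/

section Letters

/-- No wrap-around from the block CORNER: `rel ȳ x_r = r` (`0 ≤ r_ν < L^k ≤ N₀∕2`). [cite: Balaban1987RG1, (0.1)–(0.3) pp.251–252] -/
theorem rel_corner_fibreSite (hk : k ≤ P.m + P.K) (y : Site P k) (r : Fin P.d → Fin (P.L ^ k)) :
    rel (Site.fibreSite 0 k y fun _ => ⟨0, pow_pos P.L_pos k⟩) (Site.fibreSite 0 k y r) = fun ν => ((r ν : ℕ) : ℤ) := by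
  rw [fibreSite_eq_transl y r]
  refine rel_transl_of_mem _ _ fun ν => ?_
  have hN : 2 * P.L ^ k ≤ P.sitesPerDir 0 := by
    rw [sitesPerDir_zero_eq_mul_pow hk]
    have := P.one_lt_sitesPerDir k
    nlinarith [pow_pos P.L_pos k]
  have hr := (r ν).isLt
  constructor
  · have : (0 : ℤ) ≤ ((r ν : ℕ) : ℤ) * 2 := by positivity
    have : (0 : ℤ) < (P.sitesPerDir 0 : ℤ) := by exact_mod_cast (show 0 < P.sitesPerDir 0 by omega)
    linarith
  · have : ((r ν : ℕ) : ℤ) * 2 ≤ ((2 * P.L ^ k : ℕ) : ℤ) := by push_cast; linarith [show ((r ν : ℕ) : ℤ) < (P.L ^ k : ℕ) by exact_mod_cast hr]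
    exact this.trans (by exact_mod_cast hN)

/-- ★ **THE CORNER COMB IS THE CORNER AXIAL TRANSPORT**: `axialT V ȳ x_r = holT V ȳ (treeWord r)` — px5's ∕ px17's comb letter `w c r` by name. [cite: Balaban1985Averaging, p.24] -/
theorem axialT_corner_fibreSite {G : Type*} [Group G] (hk : k ≤ P.m + P.K) (V : GaugeField P 0 G) (y : Site P k) (r : Fin P.d → Fin (P.L ^ k)) :
    axialT V (Site.fibreSite 0 k y fun _ => ⟨0, pow_pos P.L_pos k⟩) (Site.fibreSite 0 k y r)
      = holT V (Site.fibreSite 0 k y fun _ => ⟨0, pow_pos P.L_pos k⟩) (treeWord fun ν => ((r ν : ℕ) : ℤ)) := by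
  unfold axialT
  rw [rel_corner_fibreSite hk y r]

/-- For unitary units: `W*·Z·W = R(W⁻¹)Z`. [folklore] -/
theorem star_mul_mul_eq_R_inv {u : (Matrix (Fin N) (Fin N) ℂ)ˣ} (hu : (u : Matrix (Fin N) (Fin N) ℂ) ∈ unitary (Matrix (Fin N) (Fin N) ℂ)) (Z : Matrix (Fin N) (Fin N) ℂ) :
    star (u : Matrix (Fin N) (Fin N) ℂ) * Z * (u : Matrix (Fin N) (Fin N) ℂ) = R u⁻¹ Z := by
  rw [B9Eq39Adjoint.R_def, inv_inv, coe_inv_eq_star hu]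

/-- For unitary units: `g·Z·g* = R(g)Z`. [folklore] -/
theorem mul_mul_star_eq_R {u : (Matrix (Fin N) (Fin N) ℂ)ˣ} (hu : (u : Matrix (Fin N) (Fin N) ℂ) ∈ unitary (Matrix (Fin N) (Fin N) ℂ)) (Z : Matrix (Fin N) (Fin N) ℂ) :
    (u : Matrix (Fin N) (Fin N) ℂ) * Z * star (u : Matrix (Fin N) (Fin N) ℂ) = R u Z := by
  rw [B9Eq39Adjoint.R_def, coe_inv_eq_star hu]

/-- **THE FAR-LAYER FACE FUNCTIONAL IS THE GAUSS OUTFLOW** for the transport `T_y := g_y · axialT V ȳ_y`: `g·(Σ_{far} conjR(holT V ȳ (treeWord r̄))B)·g* = Σ_{far} R(T_y(x_r̄))B`.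
[cite: Balaban1985Averaging, (9) p.18, p.24; Balaban1984PropagatorsI, (1.21) p.21] -/
theorem faceFar_eq_out (hk : k ≤ P.m + P.K) (V : GaugeField P 0 (Matrix (Fin N) (Fin N) ℂ)ˣ) {u : (Matrix (Fin N) (Fin N) ℂ)ˣ}
    (hu : (u : Matrix (Fin N) (Fin N) ℂ) ∈ unitary (Matrix (Fin N) (Fin N) ℂ)) (y : Site P k) (μ : Fin P.d) (Bμ : Site P 0 → Matrix (Fin N) (Fin N) ℂ) :
    (u : Matrix (Fin N) (Fin N) ℂ) * (∑ r ∈ univ.filter (fun r : Fin P.d → Fin (P.L ^ k) => (r μ : ℕ) + 1 = P.L ^ k),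
        conjR (holT V (Site.fibreSite 0 k y fun _ => ⟨0, pow_pos P.L_pos k⟩) (treeWord fun ν => ((r ν : ℕ) : ℤ))) (Bμ (Site.fibreSite 0 k y r)))
      * star (u : Matrix (Fin N) (Fin N) ℂ)
      = ∑ r ∈ univ.filter (fun r : Fin P.d → Fin (P.L ^ k) => (r μ : ℕ) + 1 = P.L ^ k),
          R (u * axialT V (Site.fibreSite 0 k y fun _ => ⟨0, pow_pos P.L_pos k⟩) (Site.fibreSite 0 k y r)) (Bμ (Site.fibreSite 0 k y r)) := by
  rw [mul_mul_star_eq_R hu, Prop7CovCombGauss.R_finset_sum]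
  refine Finset.sum_congr rfl fun r _ => ?_
  rw [B9Eq39Adjoint.R_mul, axialT_corner_fibreSite hk V y r]
  rfl

/-- ★ **LINE-MATES IN px5's LETTERS**: with `t₀ = ℓ − 1 − r_μ` (far-face crossing) and `s′ = ℓ − 1`, the all-offsets comb-direct face sum of ✓p670095 ∕ ✓p680744 is `ℓ` copies of the far-layer sum:
`Σ_r conjR(holT V ȳ (treeWord (r with r_μ ↦ ℓ−1)))(B⟨shift^{ℓ−1−r_μ} x_r, μ⟩) = Σ_{r̄ far} Σ_{s < ℓ} conjR(holT V ȳ (treeWord r̄))(B⟨x_r̄, μ⟩)`.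
[cite: Balaban1985Variational, (45)-(46) p.285; Balaban1984PropagatorsI, (1.18) p.20] -/
theorem faceSum_allOffsets_eq_far {G : Type*} [Group G] {M : Type*} [AddCommMonoid M] (V : GaugeField P 0 G) (y : Site P k) (μ : Fin P.d)
    (F : G → Site P 0 → M) :
    ∑ r : Fin P.d → Fin (P.L ^ k),
        F (holT V (Site.fibreSite 0 k y fun _ => ⟨0, pow_pos P.L_pos k⟩)
              (treeWord fun ν => ((Function.update r μ ⟨P.L ^ k - 1, Nat.sub_lt (pow_pos P.L_pos k) one_pos⟩ ν : ℕ) : ℤ)))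
          ((fun z : Site P 0 => z.shift μ)^[P.L ^ k - 1 - (r μ : ℕ)] (Site.fibreSite 0 k y r))
      = ∑ rbar ∈ univ.filter (fun r : Fin P.d → Fin (P.L ^ k) => (r μ : ℕ) + 1 = P.L ^ k), ∑ _s : Fin (P.L ^ k),
          F (holT V (Site.fibreSite 0 k y fun _ => ⟨0, pow_pos P.L_pos k⟩) (treeWord fun ν => ((rbar ν : ℕ) : ℤ))) (Site.fibreSite 0 k y rbar) := by
  rw [sum_eq_sum_far_layer_lines μ]
  refine Finset.sum_congr rfl fun rbar hrbar => Finset.sum_congr rfl fun s _ => ?_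
  have hr : (rbar μ : ℕ) + 1 = P.L ^ k := (Finset.mem_filter.mp hrbar).2
  -- the face point of the line `rbar with μ ↦ s` is `x_rbar`, and its comb is `rbar`'s
  have hup : Function.update (Function.update rbar μ s) μ ⟨P.L ^ k - 1, Nat.sub_lt (pow_pos P.L_pos k) one_pos⟩ = rbar :=
    update_update_eq_self rbar μ _ _ (by show P.L ^ k - 1 = (rbar μ : ℕ); omega)
  have hlt : ((Function.update rbar μ s) μ : ℕ) + (P.L ^ k - 1 - ((Function.update rbar μ s) μ : ℕ)) < P.L ^ k := by
    simp only [Function.update_self]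
    have := s.isLt
    omega
  rw [hup, iterate_shift_fibreSite_of_lt y _ μ _ hlt]
  congr 1
  exact congrArg _ (update_update_eq_self rbar μ _ _ (by simp only [Function.update_self]; have := s.isLt; omega))

end Letters

/-! ## §2 The exact split of the Gauss pairing -/

section Split

variable (hk : k ≤ P.m + P.K) (h : P.sitesPerDir 0 = P.L ^ k * P.sitesPerDir k)
  {V : GaugeField P 0 (Matrix (Fin N) (Fin N) ℂ)ˣ} (hV : ∀ b, V b ∈ unitaryUnits (Matrix (Fin N) (Fin N) ℂ))
  {Wc : PBond P k → (Matrix (Fin N) (Fin N) ℂ)ˣ} (hWc : ∀ c, (Wc c : Matrix (Fin N) (Fin N) ℂ) ∈ unitary (Matrix (Fin N) (Fin N) ℂ))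
  {g : Site P k → (Matrix (Fin N) (Fin N) ℂ)ˣ} (hg : ∀ y, (g y : Matrix (Fin N) (Fin N) ℂ) ∈ unitary (Matrix (Fin N) (Fin N) ℂ))

include hk h hV hWc hg in
/-- ★★★ **THE GAUSS PAIRING SPLITS EXACTLY**: for co-closed `B`,
`Σ_c Re tr((φ c₋ − W̄_c φ c₊ W̄_c*)ᴴ · FACE°_c) = Σ_y Σ_μ Σ_{r_μ+1<L^k} Re tr((D_{V,μ}Ψ^{T_y}(x_r))ᴴ·B_μ(x_r)) + Σ_y Re tr(φ(y)ᴴ·J_VH(y))`, `T_y = g_y·axialT V ȳ_y`, `J_VH` the junction of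
✓ `block_netFlux_eq_int_add_junction` at these transports and the coarse units `W̄`. [cite: Balaban1984PropagatorsI, (1.21) p.21; Balaban1985BackgroundPropagators, (3.3)-(3.8) pp.390-392; Balaban1985Averaging, (9) p.18] -/
theorem gauss_pairing_eq_int_add_junction (φ : Site P k → Matrix (Fin N) (Fin N) ℂ) (B : Fin P.d → Site P 0 → Matrix (Fin N) (Fin N) ℂ)
    (hB : ∀ x : Site P 0, divB (torusT P 0) (fun κ z => V ⟨z, κ⟩) B x = 0) :
    ∑ c : PBond P k, (((φ c.src - (Wc c : Matrix (Fin N) (Fin N) ℂ) * φ c.tgt * star (Wc c : Matrix (Fin N) (Fin N) ℂ))ᴴ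
        * ((g c.src : Matrix (Fin N) (Fin N) ℂ)
            * (∑ r ∈ univ.filter (fun r : Fin P.d → Fin (P.L ^ k) => (r c.dir : ℕ) + 1 = P.L ^ k),
                conjR (holT V (Site.fibreSite 0 k c.src fun _ => ⟨0, pow_pos P.L_pos k⟩) (treeWord fun ν => ((r ν : ℕ) : ℤ))) (B c.dir (Site.fibreSite 0 k c.src r)))
            * star (g c.src : Matrix (Fin N) (Fin N) ℂ))).trace).re
      = (∑ y : Site P k, ∑ μ : Fin P.d, ∑ r ∈ univ.filter (fun r : Fin P.d → Fin (P.L ^ k) => (r μ : ℕ) + 1 < P.L ^ k),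
          (((covD (torusT P 0) (fun κ z => V ⟨z, κ⟩) μ
              (fun z => R (g y * axialT V (Site.fibreSite 0 k y fun _ => ⟨0, pow_pos P.L_pos k⟩) z)⁻¹ (φ y)) (Site.fibreSite 0 k y r))ᴴ
              * B μ (Site.fibreSite 0 k y r)).trace).re)
        + ∑ y : Site P k, (((φ y)ᴴ * ∑ μ : Fin P.d, ∑ r ∈ univ.filter (fun r : Fin P.d → Fin (P.L ^ k) => (r μ : ℕ) + 1 = P.L ^ k),
            (R (g y * axialT V (Site.fibreSite 0 k y fun _ => ⟨0, pow_pos P.L_pos k⟩) (Site.fibreSite 0 k y (Function.update r μ ⟨0, pow_pos P.L_pos k⟩))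
                  * (V ⟨Site.fibreSite 0 k (y.unshift μ) r, μ⟩)⁻¹) (B μ (Site.fibreSite 0 k (y.unshift μ) r))
              - R ((Wc ⟨y.unshift μ, μ⟩)⁻¹ * (g (y.unshift μ) * axialT V (Site.fibreSite 0 k (y.unshift μ) fun _ => ⟨0, pow_pos P.L_pos k⟩) (Site.fibreSite 0 k (y.unshift μ) r)))
                  (B μ (Site.fibreSite 0 k (y.unshift μ) r)))).trace).re := by
  -- the transport family and the outflow letter
  set T : Site P k → Site P 0 → (Matrix (Fin N) (Fin N) ℂ)ˣ := fun y x => g y * axialT V (Site.fibreSite 0 k y fun _ => ⟨0, pow_pos P.L_pos k⟩) x with hT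
  have hTu : ∀ y x, (T y x : Matrix (Fin N) (Fin N) ℂ) ∈ unitary (Matrix (Fin N) (Fin N) ℂ) := fun y x => by
    rw [hT, Units.val_mul]
    exact Submonoid.mul_mem _ (hg y) (axialT_mem_unitary hV _ x)
  set OUT : PBond P k → Matrix (Fin N) (Fin N) ℂ := fun c => ∑ r ∈ univ.filter (fun r : Fin P.d → Fin (P.L ^ k) => (r c.dir : ℕ) + 1 = P.L ^ k),
      R (T c.src (Site.fibreSite 0 k c.src r)) (B c.dir (Site.fibreSite 0 k c.src r)) with hOUT
  -- step 1: the face functional is the outflow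
  have hface : ∀ c : PBond P k, (g c.src : Matrix (Fin N) (Fin N) ℂ)
        * (∑ r ∈ univ.filter (fun r : Fin P.d → Fin (P.L ^ k) => (r c.dir : ℕ) + 1 = P.L ^ k),
            conjR (holT V (Site.fibreSite 0 k c.src fun _ => ⟨0, pow_pos P.L_pos k⟩) (treeWord fun ν => ((r ν : ℕ) : ℤ))) (B c.dir (Site.fibreSite 0 k c.src r)))
        * star (g c.src : Matrix (Fin N) (Fin N) ℂ) = OUT c := fun c => faceFar_eq_out hk V (hg c.src) c.src c.dir (B c.dir)
  simp_rw [hface]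
  -- step 2: coarse summation by parts
  rw [sum_re_trace_pureGauge_mul_eq φ (fun c => (Wc c : Matrix (Fin N) (Fin N) ℂ)) OUT]
  -- step 3: per block, the net flux is INT + J_VH
  have hnet : ∀ y : Site P k, ∑ μ : Fin P.d, (OUT ⟨y, μ⟩ - star (Wc ⟨y.unshift μ, μ⟩ : Matrix (Fin N) (Fin N) ℂ) * OUT ⟨y.unshift μ, μ⟩ * (Wc ⟨y.unshift μ, μ⟩ : Matrix (Fin N) (Fin N) ℂ))
      = ∑ μ : Fin P.d, ∑ r ∈ univ.filter (fun r : Fin P.d → Fin (P.L ^ k) => (r μ : ℕ) + 1 < P.L ^ k),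
            R (T y (Site.fibreSite 0 k y r)) (R ((T y (Site.fibreSite 0 k y r))⁻¹
                * T y (Site.fibreSite 0 k y (Function.update r μ ⟨min ((r μ : ℕ) + 1) (P.L ^ k - 1), by have := (r μ).isLt; omega⟩))
                * (V ⟨Site.fibreSite 0 k y r, μ⟩)⁻¹) (B μ (Site.fibreSite 0 k y r)) - B μ (Site.fibreSite 0 k y r))
        + ∑ μ : Fin P.d, ∑ r ∈ univ.filter (fun r : Fin P.d → Fin (P.L ^ k) => (r μ : ℕ) + 1 = P.L ^ k),
            (R (T y (Site.fibreSite 0 k y (Function.update r μ ⟨0, pow_pos P.L_pos k⟩)) * (V ⟨Site.fibreSite 0 k (y.unshift μ) r, μ⟩)⁻¹) (B μ (Site.fibreSite 0 k (y.unshift μ) r))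
              - R ((Wc ⟨y.unshift μ, μ⟩)⁻¹ * T (y.unshift μ) (Site.fibreSite 0 k (y.unshift μ) r)) (B μ (Site.fibreSite 0 k (y.unshift μ) r))) := by
    intro y
    have hG := block_netFlux_eq_int_add_junction h (fun y' r => T y' (Site.fibreSite 0 k y' r)) (fun μ y' => Wc ⟨y', μ⟩) (fun κ z => V ⟨z, κ⟩) B hB y
    rw [← hG]
    refine Finset.sum_congr rfl fun μ _ => ?_
    rw [star_mul_mul_eq_R_inv (hWc _)]
  simp_rw [hnet, Matrix.mul_add, Matrix.trace_add, Complex.add_re, Finset.sum_add_distrib]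
  congr 1
  exact Finset.sum_congr rfl fun y _ => re_trace_int_eq_sum_covD_pairing_of_transport hV (T y) (hTu y) y B (φ y)

end Split

/-! ## §3 The door: hXb′ ⟸ hDirGauss ∧ hVH (up to the knit's scalars) -/

section Door

variable (hk : k ≤ P.m + P.K) (h : P.sitesPerDir 0 = P.L ^ k * P.sitesPerDir k)
  {V : GaugeField P 0 (Matrix (Fin N) (Fin N) ℂ)ˣ} (hV : ∀ b, V b ∈ unitaryUnits (Matrix (Fin N) (Fin N) ℂ))
  {Wc : PBond P k → (Matrix (Fin N) (Fin N) ℂ)ˣ} (hWc : ∀ c, (Wc c : Matrix (Fin N) (Fin N) ℂ) ∈ unitary (Matrix (Fin N) (Fin N) ℂ))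
  {g : Site P k → (Matrix (Fin N) (Fin N) ℂ)ˣ} (hg : ∀ y, (g y : Matrix (Fin N) (Fin N) ℂ) ∈ unitary (Matrix (Fin N) (Fin N) ℂ))

include hk h hV hWc hg in
/-- ★★★ **GAUSS-SPLIT, BOOKED**: for co-closed `B` and every `a > 0`,
`2|Σ_c Re tr(D_cᴴ·FACE°_c)| ≤ a·Σ_yΣ_μΣ_{r_μ+1<L^k}|D_{V,μ}Ψ^{T_y}(x_r)|²_HS + a⁻¹·Σ_xΣ_μ|B_μ(x)|²_HS + 2|Σ_y Re tr(φ(y)ᴴ·J_VH(y))|` — the interior Dirichlet energy of the comb local models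
`Ψ^{T_y} = R(T_y ·)⁻¹φ(y)` (hDir-type, displayed by the knit) and the junction pairing (hVH, displayed).
[cite: Balaban1985Variational, (135) p.298, Prop. 7 p.299; Balaban1984PropagatorsI, (1.21) p.21; Balaban1985BackgroundPropagators, (3.3)-(3.8) pp.390-392] -/
theorem two_mul_abs_gauss_pairing_le (φ : Site P k → Matrix (Fin N) (Fin N) ℂ) (B : Fin P.d → Site P 0 → Matrix (Fin N) (Fin N) ℂ)
    (hB : ∀ x : Site P 0, divB (torusT P 0) (fun κ z => V ⟨z, κ⟩) B x = 0) {a : ℝ} (ha : 0 < a) :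
    2 * |∑ c : PBond P k, (((φ c.src - (Wc c : Matrix (Fin N) (Fin N) ℂ) * φ c.tgt * star (Wc c : Matrix (Fin N) (Fin N) ℂ))ᴴ
        * ((g c.src : Matrix (Fin N) (Fin N) ℂ)
            * (∑ r ∈ univ.filter (fun r : Fin P.d → Fin (P.L ^ k) => (r c.dir : ℕ) + 1 = P.L ^ k),
                conjR (holT V (Site.fibreSite 0 k c.src fun _ => ⟨0, pow_pos P.L_pos k⟩) (treeWord fun ν => ((r ν : ℕ) : ℤ))) (B c.dir (Site.fibreSite 0 k c.src r)))
            * star (g c.src : Matrix (Fin N) (Fin N) ℂ))).trace).re|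
      ≤ a * ∑ y : Site P k, ∑ μ : Fin P.d, ∑ r ∈ univ.filter (fun r : Fin P.d → Fin (P.L ^ k) => (r μ : ℕ) + 1 < P.L ^ k),
            ∑ j : Fin N, ∑ l : Fin N, ‖(covD (torusT P 0) (fun κ z => V ⟨z, κ⟩) μ
              (fun z => R (g y * axialT V (Site.fibreSite 0 k y fun _ => ⟨0, pow_pos P.L_pos k⟩) z)⁻¹ (φ y)) (Site.fibreSite 0 k y r)) j l‖ ^ 2
        + a⁻¹ * ∑ x : Site P 0, ∑ μ : Fin P.d, ∑ j : Fin N, ∑ l : Fin N, ‖B μ x j l‖ ^ 2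
        + 2 * |∑ y : Site P k, (((φ y)ᴴ * ∑ μ : Fin P.d, ∑ r ∈ univ.filter (fun r : Fin P.d → Fin (P.L ^ k) => (r μ : ℕ) + 1 = P.L ^ k),
            (R (g y * axialT V (Site.fibreSite 0 k y fun _ => ⟨0, pow_pos P.L_pos k⟩) (Site.fibreSite 0 k y (Function.update r μ ⟨0, pow_pos P.L_pos k⟩))
                  * (V ⟨Site.fibreSite 0 k (y.unshift μ) r, μ⟩)⁻¹) (B μ (Site.fibreSite 0 k (y.unshift μ) r))
              - R ((Wc ⟨y.unshift μ, μ⟩)⁻¹ * (g (y.unshift μ) * axialT V (Site.fibreSite 0 k (y.unshift μ) fun _ => ⟨0, pow_pos P.L_pos k⟩) (Site.fibreSite 0 k (y.unshift μ) r)))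
                  (B μ (Site.fibreSite 0 k (y.unshift μ) r)))).trace).re| := by
  rw [gauss_pairing_eq_int_add_junction hk h hV hWc hg φ B hB]
  have hTu : ∀ (y : Site P k) (x : Site P 0), ((g y * axialT V (Site.fibreSite 0 k y fun _ => ⟨0, pow_pos P.L_pos k⟩) x : (Matrix (Fin N) (Fin N) ℂ)ˣ) :
      Matrix (Fin N) (Fin N) ℂ) ∈ unitary (Matrix (Fin N) (Fin N) ℂ) := fun y x => by
    rw [Units.val_mul]
    exact Submonoid.mul_mem _ (hg y) (axialT_mem_unitary hV _ x)
  -- the interior part: INT-CS with `θ := a⁻¹`, `ℓ := 1`, after the identity of ✓p684144 read backwards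
  have hI := two_mul_abs_int_pairing_le_of_transport h hV (fun y x => g y * axialT V (Site.fibreSite 0 k y fun _ => ⟨0, pow_pos P.L_pos k⟩) x)
    hTu (inv_pos.mpr ha) one_pos φ B
  rw [Finset.sum_congr rfl fun y _ => re_trace_int_eq_sum_covD_pairing_of_transport hV _ (hTu y) y B (φ y), inv_inv, mul_one, inv_one, mul_one] at hI
  -- triangle inequality
  have htri : ∀ p q : ℝ, 2 * |p + q| ≤ 2 * |p| + 2 * |q| := fun p q => by have := abs_add_le p q; linarith
  exact (htri _ _).trans (by linarith [hI])

end Door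

/-! ## §4 The same in px5's all-offsets letters with the knit's scalars `V_k⁻¹`, `ℓ •` -/

section AllOffsets

variable (hk : k ≤ P.m + P.K) (h : P.sitesPerDir 0 = P.L ^ k * P.sitesPerDir k)
  {V : GaugeField P 0 (Matrix (Fin N) (Fin N) ℂ)ˣ} (hV : ∀ b, V b ∈ unitaryUnits (Matrix (Fin N) (Fin N) ℂ))
  {Wc : PBond P k → (Matrix (Fin N) (Fin N) ℂ)ˣ} (hWc : ∀ c, (Wc c : Matrix (Fin N) (Fin N) ℂ) ∈ unitary (Matrix (Fin N) (Fin N) ℂ))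
  {g : Site P k → (Matrix (Fin N) (Fin N) ℂ)ˣ} (hg : ∀ y, (g y : Matrix (Fin N) (Fin N) ℂ) ∈ unitary (Matrix (Fin N) (Fin N) ℂ))

/-- **THE ALL-OFFSETS COMB-DIRECT FACE FUNCTIONAL IS A SCALAR MULTIPLE OF THE FAR-LAYER ONE**: `V_k⁻¹•(g·(ℓ•Σ_r conjR(w_{r with r_μ↦ℓ−1})(B(shift^{ℓ−1−r_μ}x_r)))·g*) = (V_k⁻¹·ℓ·L^k)•(g·(Σ_{far}conjR(w r̄)(B(x_r̄)))·g*)`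
(line-mates ✓ `faceSum_allOffsets_eq_far`; `ℓ` line-mates per far-face point). [cite: Balaban1985Variational, (45)-(46) p.285] -/
theorem combFace_allOffsets_eq_smul_far (y : Site P k) (μ : Fin P.d) (Bμ : Site P 0 → Matrix (Fin N) (Fin N) ℂ) (G : Matrix (Fin N) (Fin N) ℂ) :
    (((P.L : ℝ) ^ k) ^ P.d)⁻¹ • (G * (((P.L : ℝ) ^ k) • ∑ r : Fin P.d → Fin (P.L ^ k),
        conjR (holT V (Site.fibreSite 0 k y fun _ => ⟨0, pow_pos P.L_pos k⟩)
            (treeWord fun ν => ((Function.update r μ ⟨P.L ^ k - 1, Nat.sub_lt (pow_pos P.L_pos k) one_pos⟩ ν : ℕ) : ℤ)))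
          (Bμ ((fun z : Site P 0 => z.shift μ)^[P.L ^ k - 1 - (r μ : ℕ)] (Site.fibreSite 0 k y r)))) * star G)
      = ((((P.L : ℝ) ^ k) ^ P.d)⁻¹ * ((P.L : ℝ) ^ k) * ((P.L ^ k : ℕ) : ℝ)) •
          (G * (∑ r ∈ univ.filter (fun r : Fin P.d → Fin (P.L ^ k) => (r μ : ℕ) + 1 = P.L ^ k),
              conjR (holT V (Site.fibreSite 0 k y fun _ => ⟨0, pow_pos P.L_pos k⟩) (treeWord fun ν => ((r ν : ℕ) : ℤ))) (Bμ (Site.fibreSite 0 k y r))) * star G) := by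
  rw [faceSum_allOffsets_eq_far V y μ (fun w x => conjR w (Bμ x))]
  simp only [Finset.sum_const, Finset.card_univ, Fintype.card_fin]
  rw [← Finset.smul_sum, ← Nat.cast_smul_eq_nsmul ℝ, smul_smul, Matrix.mul_smul, Matrix.smul_mul, smul_smul]
  congr 1
  ring

include hk h hV hWc hg in
/-- ★★★ **GAUSS-SPLIT IN px5's LETTERS** (✓ `Prop7RowPOfCombFaceFluxRows`' comb-direct `FACE′` with the scalars `V_k⁻¹`, `ℓ •`): for co-closed `B` and every `a > 0`,
`2|Σ_c Re tr(D_cᴴ·FACE′_c)| ≤ (V_k⁻¹·ℓ·ℓ)·(a·DIR^{HS}_int(Ψ^{T}) + a⁻¹·M^{HS}(B) + 2|Σ_y Re tr(φ(y)ᴴ·J_VH(y))|)`, `T_y = g_y·axialT V ȳ_y`.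
[cite: Balaban1985Variational, (135) p.298, Prop. 7 p.299; Balaban1984PropagatorsI, (1.18)-(1.21) pp.20-21; Balaban1985BackgroundPropagators, (3.3)-(3.8) pp.390-392] -/
theorem two_mul_abs_gauss_pairing_allOffsets_le (φ : Site P k → Matrix (Fin N) (Fin N) ℂ) (B : Fin P.d → Site P 0 → Matrix (Fin N) (Fin N) ℂ)
    (hB : ∀ x : Site P 0, divB (torusT P 0) (fun κ z => V ⟨z, κ⟩) B x = 0) {a : ℝ} (ha : 0 < a) :
    2 * |∑ c : PBond P k, (((φ c.src - (Wc c : Matrix (Fin N) (Fin N) ℂ) * φ c.tgt * star (Wc c : Matrix (Fin N) (Fin N) ℂ))ᴴ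
        * ((((P.L : ℝ) ^ k) ^ P.d)⁻¹ • ((g c.src : Matrix (Fin N) (Fin N) ℂ) * (((P.L : ℝ) ^ k) • ∑ r : Fin P.d → Fin (P.L ^ k),
            conjR (holT V (Site.fibreSite 0 k c.src fun _ => ⟨0, pow_pos P.L_pos k⟩)
                (treeWord fun ν => ((Function.update r c.dir ⟨P.L ^ k - 1, Nat.sub_lt (pow_pos P.L_pos k) one_pos⟩ ν : ℕ) : ℤ)))
              (B c.dir ((fun z : Site P 0 => z.shift c.dir)^[P.L ^ k - 1 - (r c.dir : ℕ)] (Site.fibreSite 0 k c.src r)))) * star (g c.src : Matrix (Fin N) (Fin N) ℂ)))).trace).re|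
      ≤ ((((P.L : ℝ) ^ k) ^ P.d)⁻¹ * ((P.L : ℝ) ^ k) * ((P.L ^ k : ℕ) : ℝ)) *
        (a * ∑ y : Site P k, ∑ μ : Fin P.d, ∑ r ∈ univ.filter (fun r : Fin P.d → Fin (P.L ^ k) => (r μ : ℕ) + 1 < P.L ^ k),
              ∑ j : Fin N, ∑ l : Fin N, ‖(covD (torusT P 0) (fun κ z => V ⟨z, κ⟩) μ
                (fun z => R (g y * axialT V (Site.fibreSite 0 k y fun _ => ⟨0, pow_pos P.L_pos k⟩) z)⁻¹ (φ y)) (Site.fibreSite 0 k y r)) j l‖ ^ 2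
          + a⁻¹ * ∑ x : Site P 0, ∑ μ : Fin P.d, ∑ j : Fin N, ∑ l : Fin N, ‖B μ x j l‖ ^ 2
          + 2 * |∑ y : Site P k, (((φ y)ᴴ * ∑ μ : Fin P.d, ∑ r ∈ univ.filter (fun r : Fin P.d → Fin (P.L ^ k) => (r μ : ℕ) + 1 = P.L ^ k),
              (R (g y * axialT V (Site.fibreSite 0 k y fun _ => ⟨0, pow_pos P.L_pos k⟩) (Site.fibreSite 0 k y (Function.update r μ ⟨0, pow_pos P.L_pos k⟩))
                    * (V ⟨Site.fibreSite 0 k (y.unshift μ) r, μ⟩)⁻¹) (B μ (Site.fibreSite 0 k (y.unshift μ) r))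
                - R ((Wc ⟨y.unshift μ, μ⟩)⁻¹ * (g (y.unshift μ) * axialT V (Site.fibreSite 0 k (y.unshift μ) fun _ => ⟨0, pow_pos P.L_pos k⟩) (Site.fibreSite 0 k (y.unshift μ) r)))
                    (B μ (Site.fibreSite 0 k (y.unshift μ) r)))).trace).re|) := by
  set σ : ℝ := (((P.L : ℝ) ^ k) ^ P.d)⁻¹ * ((P.L : ℝ) ^ k) * ((P.L ^ k : ℕ) : ℝ) with hσ
  have hσ0 : 0 ≤ σ := by positivity
  -- the scalar comes out of the face functional, the pairing, the trace and the sum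
  have hsc : ∀ c : PBond P k,
      (((φ c.src - (Wc c : Matrix (Fin N) (Fin N) ℂ) * φ c.tgt * star (Wc c : Matrix (Fin N) (Fin N) ℂ))ᴴ
        * ((((P.L : ℝ) ^ k) ^ P.d)⁻¹ • ((g c.src : Matrix (Fin N) (Fin N) ℂ) * (((P.L : ℝ) ^ k) • ∑ r : Fin P.d → Fin (P.L ^ k),
            conjR (holT V (Site.fibreSite 0 k c.src fun _ => ⟨0, pow_pos P.L_pos k⟩)
                (treeWord fun ν => ((Function.update r c.dir ⟨P.L ^ k - 1, Nat.sub_lt (pow_pos P.L_pos k) one_pos⟩ ν : ℕ) : ℤ)))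
              (B c.dir ((fun z : Site P 0 => z.shift c.dir)^[P.L ^ k - 1 - (r c.dir : ℕ)] (Site.fibreSite 0 k c.src r)))) * star (g c.src : Matrix (Fin N) (Fin N) ℂ)))).trace).re
      = σ * (((φ c.src - (Wc c : Matrix (Fin N) (Fin N) ℂ) * φ c.tgt * star (Wc c : Matrix (Fin N) (Fin N) ℂ))ᴴ
        * ((g c.src : Matrix (Fin N) (Fin N) ℂ)
            * (∑ r ∈ univ.filter (fun r : Fin P.d → Fin (P.L ^ k) => (r c.dir : ℕ) + 1 = P.L ^ k),
                conjR (holT V (Site.fibreSite 0 k c.src fun _ => ⟨0, pow_pos P.L_pos k⟩) (treeWord fun ν => ((r ν : ℕ) : ℤ))) (B c.dir (Site.fibreSite 0 k c.src r)))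
            * star (g c.src : Matrix (Fin N) (Fin N) ℂ))).trace).re := fun c => by
    rw [combFace_allOffsets_eq_smul_far c.src c.dir (B c.dir) (g c.src : Matrix (Fin N) (Fin N) ℂ), ← hσ, Matrix.mul_smul, Matrix.trace_smul,
      Complex.smul_re, smul_eq_mul]
  simp_rw [hsc]
  rw [← Finset.mul_sum, abs_mul, abs_of_nonneg hσ0, ← mul_assoc, mul_comm 2 σ, mul_assoc]
  exact mul_le_mul_of_nonneg_left (two_mul_abs_gauss_pairing_le hk h hV hWc hg φ B hB ha) hσ0

end AllOffsets

end Summit.QuantumFields.YangMills.Theorems.Prop7GaussCompositeSplit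

end
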